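import Summits.AtomisticToContinuum.FouriersLaw.Theses.JunctionLocality
import Summits.AtomisticToContinuum.FouriersLaw.Theorems.BoundedResponseConverges.Negative.OscillationExcluded

/-!
# Route JunctionLocality · item `SuperadditiveFekete` (stmt-AtomisticToContinuum-11751)

Pure real analysis (Fekete's lemma on the index semigroup `{N ≥ 2}`): the hypothesis `hF` of the
route's deciding theorem `JunctionLocality.closes` (the twin decl of route `ParityLiouvilleSeed` has
the identical statement).

Let `D : ℕ → ℝ` with `D N > 0` (`N ≥ 2`), `D N ≥ c > 0` for `N ≥ N₁`, resistances
`R N := (N-1)/D N` superadditive up to the constant `C` on `{N, M ≥ 2}`, and `D N ≤ ε (N-1)` for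
arbitrarily large `N`, for every `ε > 0`.  Then `D N → κ` for some `κ > 0`.

Proof.  `a N := R N - C` satisfies `a (N+M) ≥ a N + a M` (`N, M ≥ 2`); its slopes `a n / n` are
bounded above (by `1/c + |C|` for `n ≥ N₁`, finitely many `n < N₁`), so the restricted Fekete
lemma already in the tree (`boundedResponseConverges_tendsto_div_of_superadditive`, file
`Theorems/BoundedResponseConverges/Negative/OscillationExcluded.lean`) gives `a n / n → ℓ` with
`a n / n ≤ ℓ` (`n ≥ 2`).  Non-ballisticity with `ε = 1/(|C|+1)` gives some `N ≥ 2` with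
`R N ≥ |C| + 1`, i.e. `a N ≥ 1`, so `ℓ ≥ a N / N > 0`.  Finally
`D N = ((N-1)/N)/(a N / N + C/N) → 1/ℓ =: κ > 0`.
References: Fekete's subadditive lemma (Hammersley's survey); folklore.
-/

namespace Summit.AtomisticToContinuum.FouriersLaw.Theorems

open Filter Topology

/-- **`SuperadditiveFekete`** (item stmt-AtomisticToContinuum-11751; hypothesis `hF` of
`JunctionLocality.closes`): for `D : ℕ → ℝ` with `D N > 0` (`N ≥ 2`), eventually `D N ≥ c > 0`,
resistances `(N-1)/D N` superadditive up to `C` on `{N, M ≥ 2}`, and `D N ≤ ε (N-1)` for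
arbitrarily large `N` for every `ε > 0`, the sequence `D` converges to some `κ > 0`
(namely `κ = 1/ℓ`, `ℓ = lim ((N-1)/D N - C)/N > 0`). [folklore] -/
theorem superadditiveFekete_proof :
    Summit.AtomisticToContinuum.FouriersLaw.Theses.JunctionLocality.SuperadditiveFekete := by
  unfold Summit.AtomisticToContinuum.FouriersLaw.Theses.JunctionLocality.SuperadditiveFekete
  intro D C c hc hpos hev hsup hnb
  obtain ⟨N₁, hN₁⟩ := hev
  -- the superadditive sequence `a N = R N - C`
  set a : ℕ → ℝ := fun N => ((N : ℝ) - 1) / D N - C with ha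
  have hsa : ∀ n m : ℕ, 2 ≤ n → 2 ≤ m → a n + a m ≤ a (n + m) := by
    intro n m hn hm
    have := hsup n m hn hm
    simp only [ha]
    push_cast
    linarith
  -- slopes are bounded above: finitely many `n < N₁`, and `R n / n ≤ 1/c` beyond
  set M : ℝ := (∑ n ∈ Finset.range N₁, |a n / n|) + (1 / c + |C|) with hM
  have hslope : ∀ n : ℕ, 2 ≤ n → a n / n ≤ M := by
    intro n hn
    have hn0 : (0 : ℝ) < n := by exact_mod_cast (by omega : 0 < n)
    by_cases hlt : n < N₁
    · have h1 : a n / n ≤ |a n / n| := le_abs_self _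
      have h2 : |a n / n| ≤ ∑ k ∈ Finset.range N₁, |a k / k| :=
        Finset.single_le_sum (f := fun k => |a k / k|) (fun i _ => abs_nonneg _)
          (Finset.mem_range.2 hlt)
      have h3 : (0 : ℝ) ≤ 1 / c + |C| := by positivity
      linarith
    · push Not at hlt
      have hDn : c ≤ D n := hN₁ n hlt
      have hR : ((n : ℝ) - 1) / D n ≤ ((n : ℝ) - 1) / c :=
        div_le_div_of_nonneg_left (by linarith [show (2 : ℝ) ≤ n by exact_mod_cast hn]) hc hDn
      have h1 : a n / n ≤ (((n : ℝ) - 1) / c + |C|) / n := by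
        apply div_le_div_of_nonneg_right _ hn0.le
        simp only [ha]
        linarith [neg_le_abs C, le_abs_self C]
      have h2 : (((n : ℝ) - 1) / c + |C|) / n ≤ 1 / c + |C| := by
        rw [div_le_iff₀ hn0]
        have : ((n : ℝ) - 1) / c ≤ n / c := div_le_div_of_nonneg_right (by linarith) hc.le
        have h1n : (1 : ℝ) ≤ n := by exact_mod_cast (by omega : 1 ≤ n)
        have : n / c = 1 / c * n := by ring
        nlinarith [abs_nonneg C]
      have h0 : (0 : ℝ) ≤ ∑ k ∈ Finset.range N₁, |a k / k| :=
        Finset.sum_nonneg fun i _ => abs_nonneg _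
      linarith
  -- restricted Fekete (in tree): `a n / n → ℓ = sup_{n ≥ 2} a n / n`
  obtain ⟨ℓ, hℓ, hle⟩ := boundedResponseConverges_tendsto_div_of_superadditive hsa hslope
  -- `ℓ > 0` from non-ballisticity with `ε = 1/(|C|+1)`
  have hℓ0 : 0 < ℓ := by
    have hpos1 : (0 : ℝ) < |C| + 1 := by positivity
    obtain ⟨N, hN, hDN⟩ := hnb (1 / (|C| + 1)) (by positivity) 2
    have hN0 : (0 : ℝ) < N := by exact_mod_cast (by omega : 0 < N)
    have hDpos : 0 < D N := hpos N hN
    have hR : |C| + 1 ≤ ((N : ℝ) - 1) / D N := by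
      rw [le_div_iff₀ hDpos]
      calc (|C| + 1) * D N ≤ (|C| + 1) * (1 / (|C| + 1) * ((N : ℝ) - 1)) :=
            mul_le_mul_of_nonneg_left hDN hpos1.le
        _ = (N : ℝ) - 1 := by rw [← mul_assoc, mul_one_div_cancel hpos1.ne', one_mul]
    have haN : 1 ≤ a N := by
      simp only [ha]
      linarith [le_abs_self C]
    have hsN : 0 < a N / N := div_pos (by linarith) hN0
    exact lt_of_lt_of_le hsN (hle N hN)
  -- `D N = ((N-1)/N) / (a N / N + C / N) → 1 / ℓ`
  refine ⟨1 / ℓ, by positivity, ?_⟩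
  have hnum : Tendsto (fun n : ℕ => ((n : ℝ) - 1) / n) atTop (𝓝 1) := by
    have e : (fun n : ℕ => ((n : ℝ) - 1) / n) =ᶠ[atTop] fun n : ℕ => 1 - (n : ℝ)⁻¹ := by
      filter_upwards [eventually_ge_atTop 1] with n hn
      have hn0 : (n : ℝ) ≠ 0 := by exact_mod_cast (by omega : n ≠ 0)
      field_simp
    rw [tendsto_congr' e]
    simpa using (tendsto_inv_atTop_nhds_zero_nat (𝕜 := ℝ)).const_sub 1
  have hden : Tendsto (fun n : ℕ => a n / n + C / n) atTop (𝓝 ℓ) := by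
    simpa using hℓ.add (tendsto_const_div_atTop_nhds_zero_nat C)
  have hq : Tendsto (fun n : ℕ => ((n : ℝ) - 1) / n / (a n / n + C / n)) atTop (𝓝 (1 / ℓ)) :=
    hnum.div hden hℓ0.ne'
  refine hq.congr' ?_
  filter_upwards [eventually_ge_atTop 2] with n hn
  have hn0 : (n : ℝ) ≠ 0 := by exact_mod_cast (by omega : n ≠ 0)
  have hn1 : (n : ℝ) - 1 ≠ 0 := by
    have : (2 : ℝ) ≤ n := by exact_mod_cast hn
    linarith
  have hD0 : D n ≠ 0 := (hpos n hn).ne'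
  simp only [ha]
  field_simp
  have e : (n : ℝ) - 1 - D n * C + D n * C = n - 1 := by ring
  rw [e, div_self hn1]

end Summit.AtomisticToContinuum.FouriersLaw.Theorems
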